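import Literature.AnabelianGeometry.SemiGraphs.ArithBranchGeometricPartAt
import Literature.AnabelianGeometry.SemiGraphs.ArithIntersectionOfAction
import HarnessLib

/-!
# [SemiAnbd] Rmk 5.3.1 / Thm 5.4 for the produced data from the chart action — AT ONE GRAPH (proof-only twin)

Mochizuki, *Semi-graphs of Anabelioids*, Publ. RIMS **42** (2006) 221–322, §5, Rmk 5.3.1 p. 65,
Thm 5.4 (ii) p. 66. [cite: MochizukiSemiAnbd2006, Rmk 5.3.1, p. 65]

PROOF-ONLY companion of `ArithIntersectionOfAction.lean` (abc-iut cell, L3-lead ruling α4-3 (iv), seat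
abc-iut-w4-d040): the two theorems of the original that carry `hCV : CompactInVerticial` are twinned with
the per-graph `h : CompactInVerticialAt 𝒢` (abc-iut-w4-d075), decl suffix `At`, proofs ported verbatim;
originals untouched (recovered via `compactInVerticialAt_of_compactInVerticial`).  The `CompactInVerticial`-free
theorems of the original (`ArithChartAction.conj_isGeomVerticial/EdgeLike`,
`isGeomVerticial_inf_ker_of_isVerticial_ofChart`, `isVerticial_eq_of_le_ofChart_of_action`) need no twin.
No definition, no new named fact; nothing here takes a side on [IUTchIII] Cor. 3.12.
-/

namespace Literature.AnabelianGeometry.SemiGraphs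

namespace ProfiniteSemiGraph

open CategoryTheory Topology
open scoped Pointwise

universe u u' u''

variable {𝒢 : ProfiniteSemiGraph.{u}} {c : TemperedPiChart 𝒢} {Gtp : Type u'} [Group Gtp]
  {PA : Type u''} [Group PA] [TopologicalSpace PA]

/-- **The typed second sentence of Rmk 5.3.1 for the produced data, from the chart action, AT ONE GRAPH**:
twin of `intersectionWithGeometricStatement_ofChart_of_action` with `CompactInVerticialAt 𝒢`.
[cite: MochizukiSemiAnbd2006, Rmk 5.3.1, p. 65] -/
theorem intersectionWithGeometricStatement_ofChart_of_actionAt (h : CompactInVerticialAt 𝒢)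
    (h𝒢 : 𝒢.Thm37Hypotheses) (hG : 𝒢.graph.IsGraph) (R : ChartRepresentatives c) (ι : c.G →* Gtp)
    (hι : Function.Injective ι) (aug : Gtp →* PA) (hexact : ι.range = aug.ker)
    {actV : PA → 𝒢.graph.Vertex → 𝒢.graph.Vertex} {actE : PA → 𝒢.graph.Edge → 𝒢.graph.Edge}
    {actB : PA → 𝒢.graph.Branch → 𝒢.graph.Branch} (A : ArithChartAction c ι aug actV actE actB) :
    IntersectionWithGeometricStatement (decompositionDataOfChart R ι) aug
      (fun K => ∃ w : 𝒢.graph.Vertex, ∃ H ∈ verticialSubgroups c w, K = H.map ι)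
      (fun K => ∃ e : 𝒢.graph.Edge, ∃ L ∈ edgeLikeSubgroups c e, K = L.map ι) :=
  intersectionWithGeometricStatement_ofChartAt h h𝒢 hG R ι hι aug hexact A.conj_isGeomVerticial
    A.conj_isGeomEdgeLike

/-- **hVE for the produced data, AT ONE GRAPH**: no verticial subgroup of `Π^temp_𝔊` is edge-like — twin
of `not_isEdgeLike_of_isVerticial_ofChart_of_action` with `CompactInVerticialAt 𝒢`.
[cite: MochizukiSemiAnbd2006, Thm 5.4 (ii), p. 66] -/
theorem not_isEdgeLike_of_isVerticial_ofChart_of_actionAt (h : CompactInVerticialAt 𝒢)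
    (h𝒢 : 𝒢.Thm37Hypotheses) (hG : 𝒢.graph.IsGraph) (R : ChartRepresentatives c) (ι : c.G →* Gtp)
    (hι : Function.Injective ι) (aug : Gtp →* PA) (hexact : ι.range = aug.ker)
    {actV : PA → 𝒢.graph.Vertex → 𝒢.graph.Vertex} {actE : PA → 𝒢.graph.Edge → 𝒢.graph.Edge}
    {actB : PA → 𝒢.graph.Branch → 𝒢.graph.Branch} (A : ArithChartAction c ι aug actV actE actB)
    {K : Subgroup Gtp} (hK : IsVerticial (decompositionDataOfChart R ι) K) :
    ¬ IsEdgeLike (decompositionDataOfChart R ι) K :=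
  not_isEdgeLike_of_isVerticial_of_geometric
    (intersectionWithGeometricStatement_ofChart_of_actionAt h h𝒢 hG R ι hι aug hexact A)
    (fun K hKv => isGeomVerticial_not_isGeomEdgeLike h𝒢 c ι hι K hKv) hK

end ProfiniteSemiGraph

end Literature.AnabelianGeometry.SemiGraphs
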